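import Summits.AtomisticToContinuum.HydrodynamicLimit.Theses.SpeedCapSurgery
import Summits.AtomisticToContinuum.HydrodynamicLimit.Theorems.TwoClocksEntropyToHydro
import Summits.AtomisticToContinuum.HydrodynamicLimit.Theorems.SpeedCapSurgeryCappedEulerLimitStubReference
import Summits.AtomisticToContinuum.HydrodynamicLimit.Theorems.SpeedCapSurgeryCappedEulerLimitStubTimeZero
import Summits.AtomisticToContinuum.HydrodynamicLimit.Theorems.TwoClocksClampedEntropyClockDiscreteEntropyGronwall
import Summits.AtomisticToContinuum.HydrodynamicLimit.Theorems.SpeedCapSurgeryCappedEulerLimitStubKlDivNeTop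
import Summits.AtomisticToContinuum.HydrodynamicLimit.Theorems.SpeedCapSurgeryCappedEulerLimitStubKlDivZero
import HarnessLib

/-!
# Route `SpeedCapSurgery`, crux `CappedEulerLimit` (stmt-AtomisticToContinuum-17739), I: capped entropy propagation from the capped window entropy step

Line `registered` runs Yau's relative-entropy clock ON THE SPEED-CAP EVENT for the deterministic hard-sphere flow on
`𝕋³` in the packing band: the law at time `r` of the system started from the CAPPED initial law `λ_N|cap_{[0,t],C}`
(`cappedLaw`, §1) against the explicit local Gibbs reference with the thermodynamic activity `thermoActivity σ (ρ r)`.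
This file (part I of the landed reduction; part II `SpeedCapSurgeryCappedEulerLimit.lean` concludes the crux) proves

* `cappedEntropyPropagation_of_windowStep : (∃ ηw > 0, CappedWindowEntropyStepBelow ηw) → ∃ ηd > 0, CappedEntropyPropagationBelow ηd`

— the capped relative-entropy propagation `KL((Φ_N,t)_*(λ_N|cap) ‖ ψ_t)/(N+1) → 0` (§2, statement of the birth stub
`stub_cappedGronwall`) from the line's single open stub, the CAPPED WINDOW ENTROPY STEP WITH A RATE (§3,
`CappedWindowEntropyStepBelow ηw`: Nachtergaele–Yau's one-window entropy step on the cap event, amplification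
`1 + K·√log(N+2)·w'` — cut-off `M_N = C√log(N+2)` EXACT on the support of the capped law, constant linear in the cut-off,
NY 2003 §5 Lemma 5.1 — and additive one-block error `w'·(N+1)^{1-a}` WITH A RATE `a > 0`, the quantitative
local-equilibrium statement for the deterministic capped dynamics that no source proves). Ingredients: the landed stubs
`stub_cappedKlDivZero` (restricted initial relative entropy `≤ 1`, used with the time-zero identity of `stub_timeZero`) and
`stub_cappedKlDivNeTop` (finiteness), the statics `thermoActivity_spec` + `PolynomialCompressionEverywhere.integral_density_eq_one`,
and the real-analysis glue of §4: `flexible_window_gronwall` (discrete Gronwall over sub-windows of length `≤ w`, on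
`QuenchedCellClock.gronwall_iterate_le`) and `tendsto_exp_sqrt_log_mul_rpow_neg` (`e^{K√log(N+2)}·(N+1)^{-a} → 0`: the
Gronwall factor at cap `C√log(N+2)` is `N^{o(1)}` and loses against any polynomial rate — the route header's price
bookkeeping as a lemma).

Lead prover-line-stmt-AtomisticToContinuum-17739-0, cycle 1 (`--supports stmt-AtomisticToContinuum-17739`).
-/


noncomputable section

namespace Summit.AtomisticToContinuum.HydrodynamicLimit.Theorems.CappedEulerLimit

open scoped ENNReal NNReal Topology
open MeasureTheory Filter Set InformationTheory
open Literature.Analysis.FluidPDE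
open Literature.MathematicalPhysics.KineticTheory
open Summit.AtomisticToContinuum.HydrodynamicLimit.Theses.SpeedCapSurgery
open Summit.AtomisticToContinuum.HydrodynamicLimit.Theorems.KineticWindowGronwallActivityInversion

/-! ## §1 The cap event and the capped law -/

/-- **The cap event** over the time window `[0, t]` at level `C√log(N+2)`: initial data `z` all of whose
spheres stay slower than `C√log(N+2)` along the flow `Φ` at every time `r ∈ [0, t]` — verbatim the set the
crux restricts to. [cite: NachtergaeleYau2003, §5 Assumption II.1 and Lemma 5.1] -/
def capEvent (σ t C : ℝ) (N : ℕ)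
    (Φ : HardSphereFlow (Torus.geometry (Fin 3)) (hsDiameter σ N) (N + 1)) :
    Set (Config (N + 1) (Fin 3) T3) :=
  {z | ∀ r ∈ Icc 0 t, ∀ i, ‖(Φ.flow r z i).2‖ ≤ C * Real.sqrt (Real.log ((N : ℝ) + 2))}

/-- **The capped initial law**: the local Gibbs law `localGibbsLaw σ a₀ u₀ θ₀ N Φ` RESTRICTED to the cap
event over `[0, t]` at level `C√log(N+2)` (a sub-probability law; verbatim the crux's
`(localGibbsLaw …).restrict {z | …}`). [cite: NachtergaeleYau2003, §5] -/
def cappedLaw (σ : ℝ) (a₀ θ₀ : T3 → ℝ) (u₀ : T3 → V3) (t C : ℝ) (N : ℕ)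
    (Φ : HardSphereFlow (Torus.geometry (Fin 3)) (hsDiameter σ N) (N + 1)) :
    Measure (Config (N + 1) (Fin 3) T3) :=
  (localGibbsLaw σ a₀ u₀ θ₀ N Φ).restrict (capEvent σ t C N Φ)

/-! ## §2 Capped relative-entropy propagation (statement)

`RefConcentrates`, `ReferenceStaticsBelow` (+ `stub_reference`) and `TimeZeroIdentity` (+ `stub_timeZero`) are imported
from `Theorems/SpeedCapSurgeryCappedEulerLimitStub{Reference,TimeZero}.lean`. -/

/-- **Capped relative-entropy propagation below the packing threshold `ηd`** (the conclusion of Yau's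
Gronwall run on the cap event, with the statics as HYPOTHESES): for all continuous positive profiles there
is `σ₀ > 0` such that for `0 < σ < σ₀`, every classical solution with `ρ_t σ³ < ηd` on `[0,T) × 𝕋³` and every
flow family: if the initial local Gibbs laws are probability laws whose fields converge at `t = 0`, the
time-zero EOS reference IS the initial law, and the EOS reference family concentrates at every `t ∈ [0,T)`,
then for every `t ∈ [0,T)` and EVERY cap constant `C` the law at time `t` of the system started from the
CAPPED initial law `λ_N|cap_{[0,t],C}` satisfies
`H((Φ_N,t)_*(λ_N|cap) ‖ localGibbsLaw σ (thermoActivity σ (ρ t)) (u t) (θ t) N Φ_N)/(N+1) → 0`. On the support of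
the capped law every speed is `≤ C√log(N+2)` at every time `r ≤ t`, so the cubic energy current is
truncated exactly; the price is the Gronwall factor `exp(K·C√log(N+2)·t) = N^{o(1)}`, to be beaten by
RATES in the one-block step. [cite: Yau1991, §2 Thm] [cite: OllaVaradhanYau1993, §3 and §5 Thm 5.1]
[cite: NachtergaeleYau2003, §5 Lemma 5.1 and §7.2] -/
def CappedEntropyPropagationBelow (ηd : ℝ) : Prop :=
  ∀ (a₀ θ₀ : T3 → ℝ) (u₀ : T3 → V3), Continuous a₀ → Continuous θ₀ → Continuous u₀ →
    (∀ x, 0 < a₀ x) → (∀ x, 0 < θ₀ x) →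
    ∃ σ₀ : ℝ, 0 < σ₀ ∧ ∀ σ : ℝ, 0 < σ → σ < σ₀ →
      ∀ (T : ℝ) (ρ θ : ℝ → T3 → ℝ) (u : ℝ → T3 → V3), IsHardSphereEulerSolution σ T ρ u θ →
        (∀ t ∈ Ico 0 T, ∀ x, ρ t x * σ ^ 3 < ηd) →
        ∀ Φ : (N : ℕ) → HardSphereFlow (Torus.geometry (Fin 3)) (hsDiameter σ N) (N + 1),
          (∀ N, IsProbabilityMeasure (localGibbsLaw σ a₀ u₀ θ₀ N (Φ N))) →
          TendstoHydroFieldsAt (fun N => localGibbsLaw σ a₀ u₀ θ₀ N (Φ N)) Φ ρ u θ 0 →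
          (∀ N : ℕ, localGibbsLaw σ (thermoActivity σ (ρ 0)) (u 0) (θ 0) N (Φ N) =
            localGibbsLaw σ a₀ u₀ θ₀ N (Φ N)) →
          (∀ t ∈ Ico 0 T, RefConcentrates σ (ρ t) (θ t) (u t) Φ) →
          ∀ t ∈ Ico 0 T, ∀ C : ℝ,
            Tendsto (fun N : ℕ => klDiv ((Φ N).lawAt (cappedLaw σ a₀ θ₀ u₀ t C N (Φ N)) t)
                (localGibbsLaw σ (thermoActivity σ (ρ t)) (u t) (θ t) N (Φ N)) / ((N : ℝ≥0∞) + 1))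
              atTop (𝓝 0)

/-! ## §3 The residual hypothesis: the capped window entropy step with a rate -/

/-- **The capped WINDOW ENTROPY STEP with a polynomial one-block rate, below the packing threshold `ηw`**
(the statement of the line's residual stub `stub_cappedWindowStep`): in the frame of `CappedEntropyPropagationBelow`
(profiles, `σ < σ₀`, classical solution in the band `ρ_t σ³ < ηw`, flow family, probability initial laws with
the `t = 0` LLN, time-zero identity, concentrating thermodynamic reference family), for every `t ∈ [0,T)` and
every cap constant `C` there are a constant `K ≥ 0`, a RATE `a > 0`, window lengths `w_N > 0` and `N₀` such
that for `N ≥ N₀` every sub-window `[s, s + w'] ⊆ [0, t]` of length `0 < w' ≤ w_N` costs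
`H_N(s + w') ≤ (1 + K·√log(N+2)·w')·H_N(s) + w'·(N+1)^{1-a}`, where
`H_N(r) := (KL((Φ_N,r)_*(λ_N|cap_{t,C}) ‖ localGibbsLaw σ (thermoActivity σ (ρ r)) (u r) (θ r) N Φ_N)).toReal`
is Yau's relative entropy of the law at time `r` of the system started from the CAPPED initial law against
the thermodynamic reference. This is Nachtergaele–Yau's differential inequality `H' ≤ δ⁻¹M (H + N·ω)` on the
cap event (cut-off `M = M_N = C√log(N+2)` EXACT on the support, no Chebyshev term; constant linear in `M`,
§5 Lemma 5.1) integrated over one window, with the one-block replacement error `ω_N ≤ N^{-a}` carrying a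
RATE — the quantitative local-equilibrium statement for the deterministic capped dynamics that no source
proves (OVY 1993 obtain `ω_N → 0` rate-free and only with noise). [cite: NachtergaeleYau2003, §5 Lemma 5.1 and §7.2]
[cite: OllaVaradhanYau1993, §3 and §5 Thm 5.1] [cite: Yau1991, §2] -/
def CappedWindowEntropyStepBelow (ηw : ℝ) : Prop :=
  ∀ (a₀ θ₀ : T3 → ℝ) (u₀ : T3 → V3), Continuous a₀ → Continuous θ₀ → Continuous u₀ →
    (∀ x, 0 < a₀ x) → (∀ x, 0 < θ₀ x) →
    ∃ σ₀ : ℝ, 0 < σ₀ ∧ ∀ σ : ℝ, 0 < σ → σ < σ₀ →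
      ∀ (T : ℝ) (ρ θ : ℝ → T3 → ℝ) (u : ℝ → T3 → V3), IsHardSphereEulerSolution σ T ρ u θ →
        (∀ t ∈ Ico 0 T, ∀ x, ρ t x * σ ^ 3 < ηw) →
        ∀ Φ : (N : ℕ) → HardSphereFlow (Torus.geometry (Fin 3)) (hsDiameter σ N) (N + 1),
          (∀ N, IsProbabilityMeasure (localGibbsLaw σ a₀ u₀ θ₀ N (Φ N))) →
          TendstoHydroFieldsAt (fun N => localGibbsLaw σ a₀ u₀ θ₀ N (Φ N)) Φ ρ u θ 0 →
          (∀ N : ℕ, localGibbsLaw σ (thermoActivity σ (ρ 0)) (u 0) (θ 0) N (Φ N) =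
            localGibbsLaw σ a₀ u₀ θ₀ N (Φ N)) →
          (∀ t ∈ Ico 0 T, RefConcentrates σ (ρ t) (θ t) (u t) Φ) →
          ∀ t ∈ Ico 0 T, ∀ C : ℝ, ∃ K a : ℝ, 0 ≤ K ∧ 0 < a ∧ ∃ w : ℕ → ℝ, (∀ N, 0 < w N) ∧
            ∃ N₀ : ℕ, ∀ N : ℕ, N₀ ≤ N → ∀ s w' : ℝ, 0 ≤ s → 0 < w' → w' ≤ w N → s + w' ≤ t →
              (klDiv ((Φ N).lawAt (cappedLaw σ a₀ θ₀ u₀ t C N (Φ N)) (s + w'))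
                  (localGibbsLaw σ (thermoActivity σ (ρ (s + w'))) (u (s + w')) (θ (s + w'))
                    N (Φ N))).toReal ≤
                (1 + K * Real.sqrt (Real.log ((N : ℝ) + 2)) * w') *
                    (klDiv ((Φ N).lawAt (cappedLaw σ a₀ θ₀ u₀ t C N (Φ N)) s)
                      (localGibbsLaw σ (thermoActivity σ (ρ s)) (u s) (θ s) N (Φ N))).toReal +
                  w' * ((N : ℝ) + 1) ^ (1 - a)

/-! ## §4 Real-analysis glue: flexible-window Gronwall and the rate arithmetic -/

/-- **Flexible-window discrete Gronwall.** If `F ≥ 0` and every sub-window `[s, s + w'] ⊆ [0, t]` of length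
`0 < w' ≤ w` costs `F (s + w') ≤ (1 + A w') F s + w' b` (`A, b ≥ 0`), then `F t ≤ e^{A t} (F 0 + t b)`:
iterate along the grid `k w`, `k ≤ ⌊t/w⌋` (`QuenchedCellClock.gronwall_iterate_le`), close with the last
window of length `t − ⌊t/w⌋ w < w`, and use `(1 + A w')(1 + A w)^K ≤ e^{A t}`. [folklore] -/
theorem flexible_window_gronwall (F : ℝ → ℝ) {t A w b : ℝ} (ht : 0 ≤ t) (hA : 0 ≤ A) (hw : 0 < w)
    (hb : 0 ≤ b) (hF0 : ∀ s, 0 ≤ F s)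
    (hstep : ∀ s w' : ℝ, 0 ≤ s → 0 < w' → w' ≤ w → s + w' ≤ t →
      F (s + w') ≤ (1 + A * w') * F s + w' * b) :
    F t ≤ Real.exp (A * t) * (F 0 + t * b) := by
  set K := ⌊t / w⌋₊ with hK_def
  have hKle : (K : ℝ) * w ≤ t := by
    have : (K : ℝ) ≤ t / w := Nat.floor_le (div_nonneg ht hw.le)
    rwa [le_div_iff₀ hw] at this
  have hKlt : t < (K : ℝ) * w + w := by
    have : t / w < (K : ℝ) + 1 := Nat.lt_floor_add_one _
    rw [div_lt_iff₀ hw] at this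
    linarith
  -- the grid recursion
  have hrec : ∀ k, k < K →
      F (((k + 1 : ℕ) : ℝ) * w) ≤ (1 + A * w) * F ((k : ℝ) * w) + w * b := by
    intro k hk
    have hs0 : 0 ≤ (k : ℝ) * w := by positivity
    have hs1 : (k : ℝ) * w + w ≤ t := by
      have hk1 : (k : ℝ) + 1 ≤ K := by exact_mod_cast hk
      have : ((k : ℝ) + 1) * w ≤ (K : ℝ) * w := mul_le_mul_of_nonneg_right hk1 hw.le
      linarith
    have := hstep _ w hs0 hw le_rfl hs1
    push_cast
    rw [add_mul, one_mul]
    exact this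
  have hiter := QuenchedCellClock.gronwall_iterate_le (fun k => F ((k : ℝ) * w)) (a := A * w) (b := w * b)
    (by positivity) (by positivity) K hrec K le_rfl
  simp only [Nat.cast_zero, zero_mul] at hiter
  -- nonnegativity of the accumulated data and `K w b ≤ t b`
  have hdata0 : 0 ≤ F 0 + (K : ℝ) * (w * b) := by have := hF0 0; positivity
  have hdata : F 0 + (K : ℝ) * (w * b) ≤ F 0 + t * b := by
    have : (K : ℝ) * w * b ≤ t * b := mul_le_mul_of_nonneg_right hKle hb
    nlinarith [this]
  -- the last (possibly empty) window
  set w' := t - (K : ℝ) * w with hw'_def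
  have hw'0 : 0 ≤ w' := by rw [hw'_def]; linarith
  have hw'w : w' ≤ w := by rw [hw'_def]; linarith
  have hexp1 : (1 : ℝ) ≤ Real.exp (A * t) := Real.one_le_exp (by positivity)
  -- `(1 + A w') (1 + A w)^K ≤ e^{A t}`
  have hpow : (1 + A * w') * (1 + A * w) ^ K ≤ Real.exp (A * t) := by
    have h1 : (1 + A * w) ^ K ≤ Real.exp (A * w) ^ K :=
      pow_le_pow_left₀ (by positivity) (by linarith [Real.add_one_le_exp (A * w)]) K
    have h2 : 1 + A * w' ≤ Real.exp (A * w') := by linarith [Real.add_one_le_exp (A * w')]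
    calc (1 + A * w') * (1 + A * w) ^ K ≤ Real.exp (A * w') * Real.exp (A * w) ^ K :=
          mul_le_mul h2 h1 (by positivity) (by positivity)
      _ = Real.exp (A * w' + K * (A * w)) := by rw [← Real.exp_nat_mul, ← Real.exp_add]
      _ = Real.exp (A * t) := by congr 1; rw [hw'_def]; ring
  rcases hw'0.eq_or_lt with hzero | hpos
  · -- the grid ends exactly at `t`
    have htK : t = (K : ℝ) * w := by rw [hw'_def] at hzero; linarith
    have hpowK : (1 + A * w) ^ K ≤ Real.exp (A * t) := by
      have h1K : (1 : ℝ) ≤ 1 + A * w' := by nlinarith [hA, hw'0]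
      calc (1 + A * w) ^ K = 1 * (1 + A * w) ^ K := (one_mul _).symm
        _ ≤ (1 + A * w') * (1 + A * w) ^ K := mul_le_mul_of_nonneg_right h1K (by positivity)
        _ ≤ Real.exp (A * t) := hpow
    calc F t = F ((K : ℝ) * w) := by rw [htK]
      _ ≤ (1 + A * w) ^ K * (F 0 + (K : ℝ) * (w * b)) := hiter
      _ ≤ Real.exp (A * t) * (F 0 + (K : ℝ) * (w * b)) := mul_le_mul_of_nonneg_right hpowK hdata0
      _ ≤ Real.exp (A * t) * (F 0 + t * b) := mul_le_mul_of_nonneg_left hdata (by positivity)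
  · -- a last window of length `0 < w' ≤ w`
    have hlast := hstep ((K : ℝ) * w) w' (by positivity) hpos hw'w (by rw [hw'_def]; linarith)
    have ht' : (K : ℝ) * w + w' = t := by rw [hw'_def]; ring
    rw [ht'] at hlast
    have h1 : (1 + A * w') * F ((K : ℝ) * w) ≤ Real.exp (A * t) * (F 0 + (K : ℝ) * (w * b)) :=
      calc (1 + A * w') * F ((K : ℝ) * w)
          ≤ (1 + A * w') * ((1 + A * w) ^ K * (F 0 + (K : ℝ) * (w * b))) :=
            mul_le_mul_of_nonneg_left hiter (by positivity)
        _ = ((1 + A * w') * (1 + A * w) ^ K) * (F 0 + (K : ℝ) * (w * b)) := by ring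
        _ ≤ Real.exp (A * t) * (F 0 + (K : ℝ) * (w * b)) := mul_le_mul_of_nonneg_right hpow hdata0
    have h2 : w' * b ≤ Real.exp (A * t) * (w' * b) := le_mul_of_one_le_left (by positivity) hexp1
    calc F t ≤ (1 + A * w') * F ((K : ℝ) * w) + w' * b := hlast
      _ ≤ Real.exp (A * t) * (F 0 + (K : ℝ) * (w * b)) + Real.exp (A * t) * (w' * b) := add_le_add h1 h2
      _ = Real.exp (A * t) * (F 0 + ((K : ℝ) * w + w') * b) := by ring
      _ = Real.exp (A * t) * (F 0 + t * b) := by rw [ht']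

/-- **The rate arithmetic of the cap**: `e^{K√log(N+2)} · (N+1)^{-a} → 0` for `K ≥ 0`, `a > 0` — the Gronwall
factor at cap `C√log(N+2)` is `N^{o(1)}` and loses against any polynomial rate (route header, NUMBERS /
CHEAPEST FALSIFIER). Proof: eventually `K√log(N+2) ≤ (a/2) log(N+1)`, so the product is `≤ (N+1)^{-a/2}`.
[cite: NachtergaeleYau2003, §7.2] -/
theorem tendsto_exp_sqrt_log_mul_rpow_neg {K a : ℝ} (hK : 0 ≤ K) (ha : 0 < a) :
    Tendsto (fun N : ℕ => Real.exp (K * Real.sqrt (Real.log ((N : ℝ) + 2))) * ((N : ℝ) + 1) ^ (-a))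
      atTop (𝓝 0) := by
  -- the comparison sequence `(N+1)^{-a/2} → 0`
  have hcmp : Tendsto (fun N : ℕ => ((N : ℝ) + 1) ^ (-(a / 2))) atTop (𝓝 0) := by
    have h1 : Tendsto (fun N : ℕ => (N : ℝ) + 1) atTop atTop :=
      tendsto_atTop_add_const_right _ 1 tendsto_natCast_atTop_atTop
    exact (tendsto_rpow_neg_atTop (by positivity)).comp h1
  -- eventually `K √log(N+2) ≤ (a/2) log(N+1)`
  have hev : ∀ᶠ N : ℕ in atTop, K * Real.sqrt (Real.log ((N : ℝ) + 2)) ≤ a / 2 * Real.log ((N : ℝ) + 1) := by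
    have hlog : Tendsto (fun N : ℕ => Real.log ((N : ℝ) + 2)) atTop atTop :=
      Real.tendsto_log_atTop.comp (tendsto_atTop_add_const_right _ 2 tendsto_natCast_atTop_atTop)
    have h1 : ∀ᶠ N : ℕ in atTop, (4 * K / a) ^ 2 ≤ Real.log ((N : ℝ) + 2) := hlog.eventually_ge_atTop _
    have h2 : ∀ᶠ N : ℕ in atTop, 1 ≤ N := eventually_ge_atTop 1
    filter_upwards [h1, h2] with N hN hN1
    have hL0 : 0 ≤ Real.log ((N : ℝ) + 2) := Real.log_nonneg (by linarith [(Nat.cast_nonneg N : (0:ℝ) ≤ N)])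
    -- `√L ≤ (a / (4K)) L` in the form `K √L ≤ (a/4) L`
    have hs : K * Real.sqrt (Real.log ((N : ℝ) + 2)) ≤ a / 4 * Real.log ((N : ℝ) + 2) := by
      set L := Real.log ((N : ℝ) + 2) with hL
      have hsq : Real.sqrt L * Real.sqrt L = L := Real.mul_self_sqrt hL0
      have h4 : 4 * K / a ≤ Real.sqrt L := by
        rw [show 4 * K / a = Real.sqrt ((4 * K / a) ^ 2) by rw [Real.sqrt_sq (by positivity)]]
        exact Real.sqrt_le_sqrt hN
      have hKs : K ≤ a / 4 * Real.sqrt L := by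
        have := mul_le_mul_of_nonneg_left h4 (show (0:ℝ) ≤ a / 4 by positivity)
        calc K = a / 4 * (4 * K / a) := by field_simp
          _ ≤ a / 4 * Real.sqrt L := this
      calc K * Real.sqrt L ≤ (a / 4 * Real.sqrt L) * Real.sqrt L :=
            mul_le_mul_of_nonneg_right hKs (Real.sqrt_nonneg _)
        _ = a / 4 * L := by rw [mul_assoc, hsq]
    -- `log(N+2) ≤ 2 log(N+1)` for `N ≥ 1`
    have h22 : Real.log ((N : ℝ) + 2) ≤ 2 * Real.log ((N : ℝ) + 1) := by
      have hN1' : (1 : ℝ) ≤ N := by exact_mod_cast hN1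
      rw [← Real.log_rpow (by positivity), show ((N:ℝ) + 1) ^ (2:ℝ) = ((N:ℝ)+1) ^ (2:ℕ) by norm_cast]
      exact Real.log_le_log (by positivity) (by nlinarith)
    calc K * Real.sqrt (Real.log ((N : ℝ) + 2)) ≤ a / 4 * Real.log ((N : ℝ) + 2) := hs
      _ ≤ a / 4 * (2 * Real.log ((N : ℝ) + 1)) := mul_le_mul_of_nonneg_left h22 (by positivity)
      _ = a / 2 * Real.log ((N : ℝ) + 1) := by ring
  -- squeeze
  refine tendsto_of_tendsto_of_tendsto_of_le_of_le' tendsto_const_nhds hcmp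
    (Eventually.of_forall fun N => by positivity) ?_
  filter_upwards [hev] with N hN
  have hN1 : (0 : ℝ) < (N : ℝ) + 1 := by positivity
  calc Real.exp (K * Real.sqrt (Real.log ((N : ℝ) + 2))) * ((N : ℝ) + 1) ^ (-a)
      ≤ Real.exp (a / 2 * Real.log ((N : ℝ) + 1)) * ((N : ℝ) + 1) ^ (-a) :=
        mul_le_mul_of_nonneg_right (Real.exp_le_exp.2 hN) (by positivity)
    _ = ((N : ℝ) + 1) ^ (-(a / 2)) := by
        rw [show a / 2 * Real.log ((N : ℝ) + 1) = Real.log ((N : ℝ) + 1) * (a / 2) by ring,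
          ← Real.rpow_def_of_pos hN1, ← Real.rpow_add hN1]
        congr 1; ring


/-! ## §5 Capped entropy propagation from the window step -/

/-- **Capped relative-entropy propagation from the capped window step.** If the capped window entropy step with
a rate holds below some packing threshold (`∃ ηw > 0, CappedWindowEntropyStepBelow ηw` — the registered residual
stub `stub_cappedWindowStep` of the line), then `CappedEntropyPropagationBelow ηd` holds with
`ηd := min η₁ ηw` (`η₁ = thresh r η₂` the statics threshold of `thermoActivity_spec`) and `σ₀ := min (1/2) σw`:
for `t ∈ [0,T)`, `C`, `N ≥ N₀` the flexible-window Gronwall on `F_N(r) := H_N(r)` (`.toReal` of the capped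
relative entropy) with `A = K√log(N+2)`, `b = (N+1)^{1-a}` gives `F_N(t) ≤ e^{K√log(N+2) t}(F_N(0) + t (N+1)^{1-a})`;
`F_N(0) ≤ 1` by the time-zero identity and `stub_cappedKlDivZero`; `stub_cappedKlDivNeTop` makes
`KL_t = ofReal (F_N t)`; and `e^{K t √log(N+2)}·(1 + t)(N+1)^{-min(a,1)} → 0` (`tendsto_exp_sqrt_log_mul_rpow_neg`).
[cite: NachtergaeleYau2003, §7.2] [cite: Yau1991, §2] -/
theorem cappedEntropyPropagation_of_windowStep (hW : ∃ ηw : ℝ, 0 < ηw ∧ CappedWindowEntropyStepBelow ηw) :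
    ∃ ηd : ℝ, 0 < ηd ∧ CappedEntropyPropagationBelow ηd := by
  obtain ⟨r, hr, Rf, hsol, hbd, hcont, huniq, η₂, hη₂, -, hexp⟩ := insertionFactor_package
  obtain ⟨ηw, hηw, HW⟩ := hW
  refine ⟨min (thresh r η₂) ηw, lt_min (thresh_pos hr hη₂) hηw, ?_⟩
  intro a₀ θ₀ u₀ ha hθ hu ha0 hθ0
  obtain ⟨σw, hσw, HWσ⟩ := HW a₀ θ₀ u₀ ha hθ hu ha0 hθ0
  refine ⟨min (1 / 2) σw, lt_min (by norm_num) hσw, ?_⟩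
  intro σ hσ hσlt T ρ θ u hE hguard Φ hprob h0 hzero hfam t ht C
  have hσ2 : σ ≤ 1 / 2 := (hσlt.trans_le (min_le_left _ _)).le
  have hσw' : σ < σw := hσlt.trans_le (min_le_right _ _)
  have hg1 : ∀ s ∈ Ico 0 T, ∀ x, ρ s x * σ ^ 3 < thresh r η₂ :=
    fun s hs x => (hguard s hs x).trans_le (min_le_left _ _)
  have hgw : ∀ s ∈ Ico 0 T, ∀ x, ρ s x * σ ^ 3 < ηw :=
    fun s hs x => (hguard s hs x).trans_le (min_le_right _ _)
  -- the window step at `(t, C)`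
  obtain ⟨K, a, hK, ha', w, hw, N₀, hstep⟩ :=
    HWσ σ hσ hσw' T ρ θ u hE hgw Φ hprob h0 hzero hfam t ht C
  -- Yau's functional `F_N(r) = H_N(r)` (a real number; `0` if the divergence were infinite)
  set F : ℕ → ℝ → ℝ := fun N r =>
    (klDiv ((Φ N).lawAt (cappedLaw σ a₀ θ₀ u₀ t C N (Φ N)) r)
      (localGibbsLaw σ (thermoActivity σ (ρ r)) (u r) (θ r) N (Φ N))).toReal with hF_def
  -- time zero: `F_N(0) ≤ 1` (time-zero identity + `stub_cappedKlDivZero`)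
  have hF0 : ∀ N, F N 0 ≤ 1 := fun N => by
    simp only [hF_def, hzero N]
    refine ENNReal.toReal_le_of_le_ofReal zero_le_one ?_
    rw [ENNReal.ofReal_one]
    exact stub_cappedKlDivZero hσ2 ha hθ hu ha0 hθ0 N (Φ N) (capEvent σ t C N (Φ N))
  -- flexible-window Gronwall for `N ≥ N₀`
  have hGr : ∀ N, N₀ ≤ N → F N t ≤ Real.exp (K * Real.sqrt (Real.log ((N : ℝ) + 2)) * t) *
      (F N 0 + t * ((N : ℝ) + 1) ^ (1 - a)) := fun N hN =>
    flexible_window_gronwall (F N) ht.1 (by positivity) (hw N) (by positivity)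
      (fun _ => ENNReal.toReal_nonneg) (fun s w' hs hw' hw'le hsw => hstep N hN s w' hs hw' hw'le hsw)
  -- finiteness at time `t` (`stub_cappedKlDivNeTop` at the thermodynamic reference, continuous and positive in the band)
  have hρtc : Continuous (ρ t) := (hE.smooth_density.isSmooth_slice ht).continuous
  have hutc : Continuous (u t) := (hE.smooth_velocity.isSmooth_slice ht).continuous
  have hθtc : Continuous (θ t) := (hE.smooth_temperature.isSmooth_slice ht).continuous
  have hρ1 : ∫ x, ρ t x = 1 :=
    PolynomialCompressionEverywhere.integral_density_eq_one hσ2 ha hθ hu ha0 hθ0 hE Φ h0 ht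
  obtain ⟨-, -, hat, hat0, -⟩ := thermoActivity_spec hr hsol hbd hcont huniq hη₂ hexp hσ hρtc
    (hE.density_pos t ht) hρ1 (fun x => (hg1 t ht x).le)
  have hfin : ∀ N, klDiv ((Φ N).lawAt (cappedLaw σ a₀ θ₀ u₀ t C N (Φ N)) t)
      (localGibbsLaw σ (thermoActivity σ (ρ t)) (u t) (θ t) N (Φ N)) ≠ ⊤ := fun N =>
    stub_cappedKlDivNeTop hσ hσ2 ha hθ hu ha0 hθ0 hat hθtc hutc hat0 (hE.temperature_pos t ht) N (Φ N)
      (capEvent σ t C N (Φ N)) t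
  -- the comparison sequence `g_N → 0`
  set g : ℕ → ℝ := fun N => Real.exp (K * t * Real.sqrt (Real.log ((N : ℝ) + 2))) * ((N : ℝ) + 1) ^ (-(1 : ℝ)) +
    t * (Real.exp (K * t * Real.sqrt (Real.log ((N : ℝ) + 2))) * ((N : ℝ) + 1) ^ (-a)) with hg_def
  have hg : Tendsto g atTop (𝓝 0) := by
    have h1 := tendsto_exp_sqrt_log_mul_rpow_neg (K := K * t) (a := 1) (mul_nonneg hK ht.1) one_pos
    have h2 := (tendsto_exp_sqrt_log_mul_rpow_neg (K := K * t) (a := a) (mul_nonneg hK ht.1) ha').const_mul t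
    simpa [hg_def] using h1.add h2
  -- the real bound `F_N(t)/(N+1) ≤ g_N` for `N ≥ N₀`
  have hbound : ∀ N, N₀ ≤ N → F N t / ((N : ℝ) + 1) ≤ g N := fun N hN => by
    have hX : (0 : ℝ) < (N : ℝ) + 1 := by positivity
    have hE' : Real.exp (K * Real.sqrt (Real.log ((N : ℝ) + 2)) * t) =
        Real.exp (K * t * Real.sqrt (Real.log ((N : ℝ) + 2))) := by ring_nf
    have h1a : ((N : ℝ) + 1) ^ (1 - a) = ((N : ℝ) + 1) * ((N : ℝ) + 1) ^ (-a) := by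
      rw [sub_eq_add_neg, Real.rpow_add hX, Real.rpow_one]
    have hm1 : ((N : ℝ) + 1) ^ (-(1 : ℝ)) = ((N : ℝ) + 1)⁻¹ := Real.rpow_neg_one _
    have hle : F N t ≤ Real.exp (K * t * Real.sqrt (Real.log ((N : ℝ) + 2))) *
        (1 + t * (((N : ℝ) + 1) * ((N : ℝ) + 1) ^ (-a))) := by
      have := hGr N hN
      rw [hE', h1a] at this
      refine this.trans (mul_le_mul_of_nonneg_left ?_ (Real.exp_pos _).le)
      linarith [hF0 N]
    rw [div_le_iff₀ hX, hg_def]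
    simp only [hm1]
    have : (Real.exp (K * t * Real.sqrt (Real.log ((N : ℝ) + 2))) * ((N : ℝ) + 1)⁻¹ +
        t * (Real.exp (K * t * Real.sqrt (Real.log ((N : ℝ) + 2))) * ((N : ℝ) + 1) ^ (-a))) * ((N : ℝ) + 1) =
        Real.exp (K * t * Real.sqrt (Real.log ((N : ℝ) + 2))) *
          (1 + t * (((N : ℝ) + 1) * ((N : ℝ) + 1) ^ (-a))) := by
      field_simp
    rw [this]
    exact hle
  -- conclude in `ℝ≥0∞`
  have hlim : Tendsto (fun N : ℕ => ENNReal.ofReal (g N)) atTop (𝓝 0) := by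
    simpa using ENNReal.tendsto_ofReal hg
  refine tendsto_of_tendsto_of_tendsto_of_le_of_le' tendsto_const_nhds hlim
    (Eventually.of_forall fun _ => zero_le) ?_
  refine Filter.eventually_atTop.2 ⟨N₀, fun N hN => ?_⟩
  have hX : (0 : ℝ) < (N : ℝ) + 1 := by positivity
  have hkl : klDiv ((Φ N).lawAt (cappedLaw σ a₀ θ₀ u₀ t C N (Φ N)) t)
      (localGibbsLaw σ (thermoActivity σ (ρ t)) (u t) (θ t) N (Φ N)) = ENNReal.ofReal (F N t) := by
    rw [hF_def, ENNReal.ofReal_toReal (hfin N)]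
  have hN1 : ((N : ℝ≥0∞) + 1) = ENNReal.ofReal ((N : ℝ) + 1) := by
    rw [ENNReal.ofReal_add (Nat.cast_nonneg N) zero_le_one, ENNReal.ofReal_natCast, ENNReal.ofReal_one]
  rw [hkl, hN1, ← ENNReal.ofReal_div_of_pos hX]
  exact ENNReal.ofReal_le_ofReal (hbound N hN)

end Summit.AtomisticToContinuum.HydrodynamicLimit.Theorems.CappedEulerLimit

end
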